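import Summits.CriticalPhenomena.PercolationContinuityZ3.Theorems.PercNearOneGluingNoHeavyLowerTailPocketWitness
import HarnessLib

/-!
# `NoHeavyLowerTail` (stmt-CriticalPhenomena-4575) — the pocket bound with its witness, GLUED (sharp) form

Support file (engine seat `prim-cplus-engine` gen 9, 2026-08-20; `--supports stmt-CriticalPhenomena-4575`).  Sequel of
`…PocketWitness.lean`.  No definitions, no named facts, no sorries.

The landed per-pocket witness bound reads `μ(bad ∩ {P = S₀}) ≤ μ(Span S₀)·μ(Cl S₀ ∩ {a₀ ↮ b})`, i.e. the designated relay's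
deadness is measured with the pocket's interior FRESH.  The proof actually controls the merged (contracted) world; this file records
that sharper form:

* `PocketWitness.pocket_term_le_witness_glued` — `μ(bad ∩ {P = S₀}) ≤ μ(Span S₀)·μ(Cl S₀ ∩ {a₀ ↮ b in ω ∪ S₀⁽²⁾})`
  (`ω ∪ S₀⁽²⁾` = `ω` with every pair inside `S₀` opened; `Cl S₀ ∩ {· in ω ∪ S₀⁽²⁾}` is the law of the pocket-conditioned world
  `G^{S₀}` = `S₀` contracted to a point keeping its relay hairs, its closed Steiner boundary deleted);
* `pocketWitnessBound_glued` — summed over the pocket values for any valid witness rule `a(·)`: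
  `μ(o ↔ A, o ↮ b) ≤ Σ_{S₀} min( μ(P = S₀), μ(Span S₀)·μ(Cl S₀ ∩ {a S₀ ↮ b in ω ∪ S₀⁽²⁾}) )`.

WHY (seat memo ENGINE-g9.md §2, exact numerics g9-work/): with the weakest-PORT witness the glued sum is `≤ 1.0·t` on every structured
family tried and `≤ 1.4·t` under adversarial climbing at `n ≤ 5` (kit j078550 for `n ≤ 7`), while the fresh-interior form reaches
`1.7·t`; the conjecture "glued port-witness pocket sum `≤ C·max_a μ(a ↮ b)`" (the b-form of the selection inequality SEL, constant
`C ≈ 2` in the census) implies Kozma–Nitzan's Conjecture 3 linearly through `pocketWitnessBound_glued`.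
[cite: KozmaNitzan2024, Thm. 4 (p. 12), Lemma 5 (p. 13), Conj. 3 (p. 15)]
-/

namespace Summit.CriticalPhenomena.PercolationContinuityZ3.Theorems

open scoped BigOperators Classical
open MeasureTheory Set
open Literature.Probability.LatticeModels (prodBernoulli prodBernoulli_real_inter_of_determinedBy)
open Literature.Probability.Percolation

namespace PocketWitness

variable {n : ℕ}

/-- **Per-pocket bound with the witness exposed, GLUED (sharp) form.**  Same setting and witness as
`PocketWitness.pocket_term_le_witness`; the conclusion keeps the contraction of the pocket:
`μ({o ↔ A, o ↮ b} ∩ {pocket = S₀}) ≤ μ(S₀ internally o-spanned) · μ({∂S₀ closed} ∩ {a₀ ↮ b in ω ∪ S₀⁽²⁾})`, where `ω ∪ S₀⁽²⁾`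
opens every pair inside `S₀` (so `S₀` is one cluster): the right factor is `μ(∂S₀ closed) · μ_{G^{S₀}}(a₀ ↮ b)` for the merged world
`G^{S₀}` (`S₀` contracted, boundary deleted).  Since `{a₀ ↮ b in ω ∪ S₀⁽²⁾} ⊆ {a₀ ↮ b}` this sharpens the landed form.  Proof: identical
up to the last step, where the merge map does not see the interior pairs (`Φ(ω ∪ S₀⁽²⁾) = Φ ω`) and the reliability-transfer walk
lemma `merge_mem_openConn` is applied to `ω ∪ S₀⁽²⁾` (its boundary pairs are still closed). [this file] -/
theorem pocket_term_le_witness_glued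
    (w : Sym2 (Fin n) → unitInterval) {S₀ A : Finset (Fin n)} {o b : Fin n}
    (ho : o ∈ S₀) (hSA : Disjoint S₀ A)
    {π : Sym2 (Fin n) → Option (Sym2 (Fin n))} {Φ : Set (Sym2 (Fin n)) → Set (Sym2 (Fin n))}
    {w' : Sym2 (Fin n) → unitInterval} {F₀ : Finset (Sym2 (Fin n))}
    (hπ1 : ∀ x y, x ∉ S₀ → y ∉ S₀ → π s(x, y) = some s(x, y))
    (hπ2 : ∀ x y, x ∈ S₀ → y ∈ A → π s(x, y) = some s(o, y))
    (hπ3 : ∀ x y k, π s(x, y) = some k → (x ∉ S₀ ∧ y ∉ S₀ ∧ k = s(x, y)) ∨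
      (x ∈ S₀ ∧ y ∈ A ∧ k = s(o, y)) ∨ (y ∈ S₀ ∧ x ∈ A ∧ k = s(o, x)))
    (hΦ : ∀ ω k, k ∈ Φ ω ↔ ∃ e ∈ ω, π e = some k)
    (hw' : ∀ k, (w' k : ℝ) = 1 - ∏ e ∈ Finset.univ.filter (fun e => π e = some k), (1 - (w e : ℝ)))
    (hF₀ : ∀ x y, s(x, y) ∈ F₀ ↔ (x ∈ S₀ ∧ y ∉ S₀ ∧ y ∉ A) ∨ (y ∈ S₀ ∧ x ∉ S₀ ∧ x ∉ A))
    {a₀ : Fin n} (ha₀ : a₀ ∉ S₀)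
    (hdom : ∀ p ∈ A, (∃ x ∈ S₀, w s(x, p) ≠ 0) →
      (prodBernoulli w).real (openConnIn ((↑S₀ : Set (Fin n))ᶜ) a₀ b) ≤
        (prodBernoulli w).real (openConnIn ((↑S₀ : Set (Fin n))ᶜ) p b)) :
    (prodBernoulli w).real (((⋃ a ∈ A, openConn o a) ∩ (openConn o b)ᶜ) ∩
        {ω | ∀ v : Fin n, ω ∈ openConnIn (↑A : Set (Fin n))ᶜ o v ↔ v ∈ S₀}) ≤
      (prodBernoulli w).real {ω | ∀ v ∈ S₀, ω ∈ openConnIn (↑S₀ : Set (Fin n)) o v} *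
        (prodBernoulli w).real ({ω | ∀ e ∈ F₀, e ∉ ω} ∩
          {ω | ω ∪ (↑S₀.sym2 : Set (Sym2 (Fin n))) ∉ openConn a₀ b}) := by
  set μ := prodBernoulli w with hμ
  set Span : Set (Set (Sym2 (Fin n))) := {ω | ∀ v ∈ S₀, ω ∈ openConnIn (↑S₀ : Set (Fin n)) o v}
    with hSpan
  set Cl : Set (Set (Sym2 (Fin n))) := {ω | ∀ e ∈ F₀, e ∉ ω} with hCl
  set Bad : Set (Set (Sym2 (Fin n))) := (⋃ a ∈ A, openConn o a) ∩ (openConn o b)ᶜ with hBad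
  set Pock : Set (Set (Sym2 (Fin n))) :=
    {ω | ∀ v : Fin n, ω ∈ openConnIn (↑A : Set (Fin n))ᶜ o v ↔ v ∈ S₀} with hPock
  -- the case `b ∈ S₀`: the event is empty
  by_cases hbS : b ∈ S₀
  · have h0 : Bad ∩ Pock ⊆ ∅ := fun ω ⟨hbad, hω⟩ =>
      hbad.2 (openConnIn_subset_openConn _ o b (mem_openConnIn_of_pocket hω hbS))
    refine le_trans (measureReal_mono h0) ?_
    rw [measureReal_empty]
    exact mul_nonneg measureReal_nonneg measureReal_nonneg
  have hoA : o ∉ A := fun h => Finset.disjoint_left.1 hSA ho h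
  have ha₀o : a₀ ≠ o := fun h => ha₀ (h ▸ ho)
  have hΦ' := mk_mem_merge_iff hπ1 hπ2 hπ3 hΦ
  have hkey : ∀ Y, μ.real (Φ ⁻¹' Y) = (prodBernoulli w').real Y :=
    prodBernoulli_real_preimage_fiberMap w w' π Φ hΦ hw'
  have hdetΦ : ∀ Y, DeterminedBy (Φ ⁻¹' Y) (↑(S₀.sym2 ∪ F₀)ᶜ : Set (Sym2 (Fin n))) :=
    determinedBy_preimage_merge hπ3 hΦ hF₀ hSA
  -- pair-set bookkeeping
  have hF₀S : (↑F₀ : Set (Sym2 (Fin n))) ⊆ (↑S₀.sym2 : Set (Sym2 (Fin n)))ᶜ := by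
    intro e he heS
    rw [Finset.mem_coe] at he heS
    revert he heS
    induction e using Sym2.ind with
    | _ x y =>
    intro he heS
    rw [Finset.mk_mem_sym2_iff] at heS
    rcases (hF₀ x y).1 he with ⟨-, hy, -⟩ | ⟨-, hx, -⟩
    exacts [hy heS.2, hx heS.1]
  have hES : (↑(S₀.sym2 ∪ F₀)ᶜ : Set (Sym2 (Fin n))) ⊆ (↑S₀.sym2 : Set (Sym2 (Fin n)))ᶜ := by
    intro e he heS
    rw [Finset.coe_compl, mem_compl_iff, Finset.coe_union, mem_union] at he
    exact he (Or.inl heS)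
  have hEF : (↑(S₀.sym2 ∪ F₀)ᶜ : Set (Sym2 (Fin n))) ⊆ (↑F₀ : Set (Sym2 (Fin n)))ᶜ := by
    intro e he heF
    rw [Finset.coe_compl, mem_compl_iff, Finset.coe_union, mem_union] at he
    exact he (Or.inr heF)
  -- independence
  have hI1 : μ.real (Span ∩ (Cl ∩ Φ ⁻¹' Bad)) = μ.real Span * μ.real (Cl ∩ Φ ⁻¹' Bad) :=
    prodBernoulli_real_inter_of_determinedBy w S₀.sym2 (determinedBy_span S₀ o)
      (((determinedBy_forall_notMem F₀).mono hF₀S).inter ((hdetΦ Bad).mono hES))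
      MeasurableSet.of_discrete MeasurableSet.of_discrete
  have hI2 : ∀ Y, μ.real (Cl ∩ Φ ⁻¹' Y) = μ.real Cl * μ.real (Φ ⁻¹' Y) := fun Y =>
    prodBernoulli_real_inter_of_determinedBy w F₀ (determinedBy_forall_notMem F₀)
      ((hdetΦ Y).mono hEF) MeasurableSet.of_discrete MeasurableSet.of_discrete
  -- `o` is one-layer in the merged world
  have hiso : ∀ x : Fin n, x ≠ o → x ∉ A → w' s(o, x) = 0 := by
    intro x hxo hxA
    have h := hw' s(o, x)
    rw [Finset.filter_eq_empty_iff.2 (fun e _ => merge_ne_some hπ3 ho hxA hxo e),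
      Finset.prod_empty, sub_self] at h
    exact Set.Icc.coe_eq_zero.1 h
  -- a relay with positive merged weight from `o` is a port of `S₀`
  have hport : ∀ p ∈ A, w' s(o, p) ≠ 0 → ∃ x ∈ S₀, w s(x, p) ≠ 0 := by
    intro p hp hwp
    by_contra hno
    push Not at hno
    apply hwp
    have h := hw' s(o, p)
    have hprod : ∏ e ∈ Finset.univ.filter (fun e => π e = some s(o, p)), (1 - (w e : ℝ)) = 1 := by
      refine Finset.prod_eq_one fun e he => ?_
      rw [Finset.mem_filter] at he
      obtain ⟨-, he⟩ := he
      revert he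
      induction e using Sym2.ind with
      | _ x y =>
      intro he
      rcases hπ3 x y _ he with ⟨hx, hy, hk⟩ | ⟨hx, -, hk⟩ | ⟨hy, -, hk⟩
      · exfalso
        have : o ∈ s(x, y) := by rw [← hk]; exact Sym2.mem_mk_left o p
        rcases Sym2.mem_iff.1 this with rfl | rfl
        exacts [hx ho, hy ho]
      · rcases Sym2.eq_iff.1 hk with ⟨-, rfl⟩ | ⟨rfl, rfl⟩
        · rw [hno x hx]; simp
        · exact absurd hp hoA
      · rcases Sym2.eq_iff.1 hk with ⟨-, rfl⟩ | ⟨rfl, rfl⟩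
        · rw [Sym2.eq_swap, hno y hy]; simp
        · exact absurd hp hoA
    rw [hprod, sub_self] at h
    exact Set.Icc.coe_eq_zero.1 h
  -- avoiding-`o` reliabilities in the merged world are avoiding-`S₀` reliabilities
  have havoid : ∀ x : Fin n, x ∉ S₀ →
      (prodBernoulli w').real (openConnIn ({o}ᶜ : Set (Fin n)) x b) =
        μ.real (openConnIn ((↑S₀ : Set (Fin n))ᶜ) x b) := by
    intro x hx
    rw [← hkey]
    congr 1
    ext ω
    exact merge_mem_openConnIn_iff hΦ' ho hx ω
  have hdom' : ∀ p ∈ A, w' s(o, p) ≠ 0 →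
      (prodBernoulli w').real (openConnIn ({o}ᶜ : Set (Fin n)) a₀ b) ≤
        (prodBernoulli w').real (openConnIn ({o}ᶜ : Set (Fin n)) p b) := by
    intro p hp hwp
    have hpS : p ∉ S₀ := fun h => Finset.disjoint_left.1 hSA h hp
    rw [havoid a₀ ha₀, havoid p hpS]
    exact hdom p hp (hport p hp hwp)
  -- the heart: Theorem 4 with witness in the merged world
  have heart : μ.real Cl * (prodBernoulli w').real Bad ≤
      μ.real (Cl ∩ {ω | ω ∪ (↑S₀.sym2 : Set (Sym2 (Fin n))) ∉ openConn a₀ b}) := by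
    have h4 := KozmaNitzan2024_thm4_witness w' A o b a₀ hoA ha₀o hiso hdom'
    set U : Set (Set (Sym2 (Fin n))) := ⋃ a' ∈ A, openConn o a' with hU
    have hBadU : Bad = U \ openConn o b := by rw [hBad, Set.sdiff_eq]
    have h1 : (prodBernoulli w').real Bad ≤ (prodBernoulli w').real (U \ openConn a₀ b) := by
      rw [hBadU]
      have e1 := measureReal_inter_add_sdiff (μ := prodBernoulli w') (s := U) (t := openConn o b)
        MeasurableSet.of_discrete (measure_ne_top _ _)
      have e2 := measureReal_inter_add_sdiff (μ := prodBernoulli w') (s := U) (t := openConn a₀ b)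
        MeasurableSet.of_discrete (measure_ne_top _ _)
      have h4' : (prodBernoulli w').real (U ∩ openConn a₀ b) ≤ (prodBernoulli w').real (U ∩ openConn o b) := by
        rw [Set.inter_comm U, Set.inter_comm U]; exact h4
      linarith
    have h2 : (prodBernoulli w').real (U \ openConn a₀ b) ≤ (prodBernoulli w').real (openConn a₀ b)ᶜ :=
      measureReal_mono (fun ω hω => hω.2)
    -- the interior pairs of `S₀` are invisible to the merge map
    have hΦI : ∀ ω, Φ (ω ∪ (↑S₀.sym2 : Set (Sym2 (Fin n)))) = Φ ω := by
      intro ω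
      ext k
      rw [hΦ, hΦ]
      constructor
      · rintro ⟨e, he, hek⟩
        rcases he with he | he
        · exact ⟨e, he, hek⟩
        · exfalso
          have h' := (notMem_of_merge_eq_some hπ3 hF₀ hSA hek).1
          exact h' (Finset.mem_coe.1 he)
      · rintro ⟨e, he, hek⟩
        exact ⟨e, Or.inl he, hek⟩
    have h3 : μ.real Cl * (prodBernoulli w').real (openConn a₀ b)ᶜ ≤
        μ.real (Cl ∩ {ω | ω ∪ (↑S₀.sym2 : Set (Sym2 (Fin n))) ∉ openConn a₀ b}) := by
      rw [← hkey, ← hI2]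
      refine measureReal_mono ?_
      rintro ω ⟨hωcl, hΦω⟩
      refine ⟨hωcl, fun hab => hΦω ?_⟩
      have hcl' : ∀ e ∈ F₀, e ∉ ω ∪ (↑S₀.sym2 : Set (Sym2 (Fin n))) := by
        rintro e he (h | h)
        · exact hωcl e he h
        · exact hF₀S (Finset.mem_coe.2 he) h
      have key := merge_mem_openConn hΦ' hF₀ ho ha₀ hbS hab hcl'
      rw [hΦI] at key
      exact key
    calc μ.real Cl * (prodBernoulli w').real Bad
        ≤ μ.real Cl * (prodBernoulli w').real (openConn a₀ b)ᶜ :=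
          mul_le_mul_of_nonneg_left (h1.trans h2) measureReal_nonneg
      _ ≤ μ.real (Cl ∩ {ω | ω ∪ (↑S₀.sym2 : Set (Sym2 (Fin n))) ∉ openConn a₀ b}) := h3
  -- assemble
  have hsub : Bad ∩ Pock ⊆ Span ∩ (Cl ∩ Φ ⁻¹' Bad) := fun ω ⟨hbad, hω⟩ =>
    ⟨fun v hv => mem_openConnIn_of_pocket hω hv, fun e he => notMem_of_pocket hF₀ hω he,
      merge_mem_bad hΦ' hF₀ ho hSA hbad hω⟩
  calc μ.real (Bad ∩ Pock) ≤ μ.real (Span ∩ (Cl ∩ Φ ⁻¹' Bad)) := measureReal_mono hsub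
    _ = μ.real Span * (μ.real Cl * (prodBernoulli w').real Bad) := by rw [hI1, hI2, hkey]
    _ ≤ μ.real Span * μ.real (Cl ∩ {ω | ω ∪ (↑S₀.sym2 : Set (Sym2 (Fin n))) ∉ openConn a₀ b}) :=
        mul_le_mul_of_nonneg_left heart measureReal_nonneg


end PocketWitness

open PocketWitness in
/-- **The pocket bound with its witness, glued form, summed over the pocket values**: for every valid witness rule `a`
(`a S₀ ∉ S₀` at most as connected to `b` avoiding `S₀` as every port of `S₀`):
`μ(o ↔ A, o ↮ b) ≤ Σ_{S₀ ∋ o, S₀ ∩ A = ∅} min( μ(P = S₀), μ(S₀ internally o-spanned) · μ({∂S₀ closed} ∩ {a S₀ ↮ b in ω ∪ S₀⁽²⁾}) )`.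
[this file] -/
theorem pocketWitnessBound_glued :
    ∀ (n : ℕ) (w : Sym2 (Fin n) → unitInterval) (A : Finset (Fin n)) (o b : Fin n)
      (a : Finset (Fin n) → Fin n), o ∉ A →
      (∀ S₀ : Finset (Fin n), o ∈ S₀ → Disjoint S₀ A → a S₀ ∉ S₀ ∧
        ∀ p ∈ A, (∃ x ∈ S₀, w s(x, p) ≠ 0) →
          (Literature.Probability.LatticeModels.prodBernoulli w).real
              (Literature.Probability.Percolation.openConnIn ((↑S₀ : Set (Fin n))ᶜ) (a S₀) b) ≤
            (Literature.Probability.LatticeModels.prodBernoulli w).real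
              (Literature.Probability.Percolation.openConnIn ((↑S₀ : Set (Fin n))ᶜ) p b)) →
      (Literature.Probability.LatticeModels.prodBernoulli w).real
          ((⋃ x ∈ A, Literature.Probability.Percolation.openConn o x) ∩
            (Literature.Probability.Percolation.openConn o b)ᶜ) ≤
        ∑ S₀ ∈ (Finset.univ : Finset (Finset (Fin n))).filter (fun S₀ => o ∈ S₀ ∧ Disjoint S₀ A),
          min ((Literature.Probability.LatticeModels.prodBernoulli w).real
                {ω | ∀ v : Fin n, ω ∈ Literature.Probability.Percolation.openConnIn (↑A)ᶜ o v ↔ v ∈ S₀})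
              ((Literature.Probability.LatticeModels.prodBernoulli w).real
                  {ω | ∀ v ∈ S₀, ω ∈ Literature.Probability.Percolation.openConnIn ↑S₀ o v} *
                (Literature.Probability.LatticeModels.prodBernoulli w).real
                  ({ω | ∀ x ∈ S₀, ∀ y : Fin n, y ∉ S₀ → y ∉ A → s(x, y) ∉ ω} ∩
                    {ω | ω ∪ (↑S₀.sym2 : Set (Sym2 (Fin n))) ∉
                      Literature.Probability.Percolation.openConn (a S₀) b})) := by
  intro n w A o b a hoA hrule
  set Bad : Set (Set (Sym2 (Fin n))) := (⋃ x ∈ A, openConn o x) ∩ (openConn o b)ᶜ with hBad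
  have hoU : o ∈ (↑A : Set (Fin n))ᶜ := fun h => hoA (Finset.mem_coe.1 h)
  have hcover : Bad ⊆ ⋃ S₀ ∈ (Finset.univ : Finset (Finset (Fin n))).filter
      (fun S₀ => o ∈ S₀ ∧ Disjoint S₀ A),
      (Bad ∩ {ω | ∀ v : Fin n, ω ∈ openConnIn (↑A : Set (Fin n))ᶜ o v ↔ v ∈ S₀}) := by
    intro ω hω
    simp only [mem_iUnion, exists_prop, Finset.mem_filter, Finset.mem_univ, true_and]
    refine ⟨Finset.univ.filter (fun v => ω ∈ openConnIn (↑A : Set (Fin n))ᶜ o v), ⟨?_, ?_⟩,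
      hω, fun v => by simp⟩
    · simp only [Finset.mem_filter, Finset.mem_univ, true_and]
      exact ⟨hoU, hoU, SimpleGraph.Reachable.refl _⟩
    · refine Finset.disjoint_left.2 fun v hv hvA => ?_
      simp only [Finset.mem_filter, Finset.mem_univ, true_and] at hv
      obtain ⟨-, hvU, -⟩ := hv
      exact hvU (Finset.mem_coe.2 hvA)
  refine le_trans (measureReal_mono hcover (measure_ne_top _ _))
    (le_trans (measureReal_biUnion_finset_le _ _) ?_)
  refine Finset.sum_le_sum fun S₀ hS₀ => ?_
  simp only [Finset.mem_filter, Finset.mem_univ, true_and] at hS₀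
  obtain ⟨hoS, hSA⟩ := hS₀
  refine le_min (measureReal_mono Set.inter_subset_right) ?_
  obtain ⟨π, hπ1, hπ2, hπ3⟩ := exists_mergeFiber S₀ A o hSA
  obtain ⟨w', hw'⟩ := exists_fiberWeights w π
  obtain ⟨F₀, hF₀⟩ := exists_boundaryPairs S₀ A
  obtain ⟨haS, hdom⟩ := hrule S₀ hoS hSA
  have key := pocket_term_le_witness_glued w hoS hSA hπ1 hπ2 hπ3
    (Φ := fun ω => {k | ∃ e ∈ ω, π e = some k}) (fun _ _ => Iff.rfl) hw' hF₀ haS hdom (b := b)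
  rw [closedEvent_eq hF₀] at key
  exact key

end Summit.CriticalPhenomena.PercolationContinuityZ3.Theorems
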